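import Mathlib
import HarnessLib
import Literature.MathematicalPhysics.QuantumLattice.HubbardSectorAnalysisFactorisation

/-!
# Route `KLProgramme` — crux K3, VL child `KLRegimeVolumeLimitV17F2` (stmt-HubbardSuperconductivity-20440), located risk #8 «(VL)-DEAD-LEG», repair (α)-AUGMENTED:
# ONE SCALE OF THE DOUBLED (source-carrying) SECTOR-FIELD TOWER IS «STEP WITH THE SPECTATOR COVARIANCE, THEN ONE SUBSTITUTION» — the structural identity
# (cell gate-hubbard-kl, seat hubbard-kl-k3c4-p1 g10; pen (R59t)(ii) «structural identity = k3c4-p1 lineage»; blueprint VL-INDUCTION-BLUEPRINT-g10.md §A; `--supports` 20440)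

The VL stub reads the last-scale two-leg kernel at EVERY `(ω, k⃗)`; the in-band sector-field tower (`…TwoVolumeSectorTowerStep`, p563072) sees only legs inside the
scale-`j` ball.  The repair of record carries ≤ 2 PLAIN legs on a second copy of the labels (k3c5-p3's `Γ × Fin 2` convention, `…TwoVolumeSpectatorLegs`: copy `0`
alive, copy `1` source; spectator covariance `C′((X,s),(Y,s′)) = [s = s′ = 0]·C(X,Y)`).  The DOUBLED ANALYSIS of a momentum-space action `W` is
`map (toLin' M) W` with a matrix of DOUBLED ROWS `M((Y,0), X) = A Y X` (the alive analysis, `A = ε • E(F_j)`), `M((Y,1), X) = B Y X` (the source analysis — plain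
position space, or any fixed second block).  This file proves, generically and then for the sector families of BGM 2006 §2.7:

* `transpose_mul_spectatorCov_mul_doubleRows` — `Mᵀ · C′ · M = Aᵀ · C · A` (the source rows never meet the covariance);
* **`effAction_spectatorCov_map_doubleRows`** — `effAction C′ (map (toLin' M) W) = map (toLin' M) (effAction (AᵀCA) W)` (+ `effPartitionFn` twin): the doubled-analysed
  action FLOWS by the sector-field step with the spectator covariance — no plateau condition on the source copy (it has no covariance);
* `doubleBlock_mul_doubleRows` — the re-analysis to the next scale: for the block substitution `T⁺((Y′,0),(Y,0)) = T Y′ Y`, `T⁺((Y′,1),(Y,1)) = J Y′ Y`, zero across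
  copies, `T⁺ · M = M′` whenever `T · A = A′` and `J · B = B′` — hence `map (toLin' M′) W = map (toLin' T⁺) (map (toLin' M) W)` (`map_doubleRows_eq_map_doubleBlock_map`);
  `doubleBlock_src_of_src` / `doubleBlock_copy_iff` — `T⁺` sends sources to sources only and preserves the copy (the hypotheses of `GrassmannSourceGrading.map_mem_srcGE`
  / `srcTrunc_map_srcTrunc` and of `GrassmannSourceGradedStep.map_map_mulLeft_srcWeight_comm`);
* MODEL INSTANCE (thin/fat sector pair `(F, F̃)`, `F̃F = F`, momentum covariance `C₀` supported in the plateau `{Σ_ω F_ω = 1}`, next family `F′` inside the plateau):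
  **`effAction_spectatorCov_map_doubleRows_sector`** — with `A = ε • E(F)` and `C = S(F̃)ᵀ C₀ S(F̃)`:
  `effAction C′ (map (toLin' M) W) = map (toLin' M) (effAction C₀ W)` (`HubbardSectorAnalysisFactorisation.smul_sectorAnalysis_factorisation` at `T = 1`), i.e. with
  `W = 𝒱⁽ʲ⁾`, `C₀ = C_{(Λ_{j+1},Λ_j]}`: `effAction (C_j^{sec} ⊕ 0) D_j = [ε•E(F_j) | B]-analysis of 𝒱⁽ʲ⁺¹⁾`; and
  **`smul_sectorAnalysis_mul_sectorSub_mul_smul_sectorAnalysis`** — `(ε • E(F′)) · S(F̃) · (ε • E(F)) = ε • E(F′)` (the alive block of the re-analysis `T_j = ε•E(F_{j+1})·S(F̃_j)`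
  reproduces the next analysis), so the doubled tower reads `D_{j+1} = map (toLin' (T_j ⊕ J)) (effAction (C_j^{sec} ⊕ 0) D_j)` EXACTLY — the shape of
  `…TwoVolumeScaleSucc.twoVolume_scale_succ_le` (transfer ∘ STEP), on which the source truncation `srcTrunc 3` acts exactly scale by scale (p566122).

Model-generic; proofs only; no definition.  References: BGM 2006 §2.7 (2.70)–(2.71), §2.9 (4.3)–(4.6); Salmhofer 1999 App. B.2 (B.23)–(B.25).
-/

noncomputable section

namespace Summit.HubbardSuperconductivity.HubbardSuperconductivity.Theorems.TwoVolumeDefect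

set_option linter.dupNamespace false -- summit = problem name (single-conjunct summit), D-0017

open Finset Literature.MathematicalPhysics.QuantumLattice GrassmannAlgebra Literature.Probability.LatticeModels

/-! ## §1 Doubled rows against the spectator covariance (generic) -/

section DoubleRows

variable {R : Type*} [CommRing R] {Γ Γ₁ : Type*} [Fintype Γ] [DecidableEq Γ] [Fintype Γ₁] [DecidableEq Γ₁]
  (C : Matrix Γ₁ Γ₁ R) (C' : Matrix (Γ₁ × Fin 2) (Γ₁ × Fin 2) R)
  (hC' : ∀ p q, C' p q = if p.2 = 0 ∧ q.2 = 0 then C p.1 q.1 else 0)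
  (A B : Matrix Γ₁ Γ R) (M : Matrix (Γ₁ × Fin 2) Γ R) (hM : ∀ p X, M p X = if p.2 = 0 then A p.1 X else B p.1 X)
include hC' hM

omit [Fintype Γ] [DecidableEq Γ] [DecidableEq Γ₁] in
/-- **`Mᵀ · C′ · M = Aᵀ · C · A`**: pulled back along the doubled rows, the spectator covariance is the alive block's pull-back of `C` — the source rows never meet it.
[cite: Salmhofer1999, App. B.2 (B.23)-(B.25)] -/
theorem transpose_mul_spectatorCov_mul_doubleRows : M.transpose * C' * M = A.transpose * C * A := by
  have h10 : ¬ ((1 : Fin 2) = 0) := by decide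
  ext X Y
  have hinner : ∀ q : Γ₁ × Fin 2, (M.transpose * C') X q = if q.2 = 0 then ∑ a, A a X * C a q.1 else 0 := by
    intro q
    rw [Matrix.mul_apply, Fintype.sum_prod_type]
    simp only [Matrix.transpose_apply, Fin.sum_univ_two, hM, hC', Fin.isValue, if_true, h10, if_false, false_and, mul_zero, add_zero]
    by_cases hq : q.2 = 0
    · simp only [hq, and_true, if_true]
    · simp only [hq, and_false, if_false, mul_zero, sum_const_zero]
  rw [Matrix.mul_apply, Fintype.sum_prod_type]
  simp only [hinner, Fin.sum_univ_two, Fin.isValue, if_true, h10, if_false, zero_mul, add_zero, hM]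
  simp only [Matrix.mul_apply, Matrix.transpose_apply]

omit [DecidableEq Γ₁] in
/-- **The doubled-analysed action flows by the spectator step**: `effAction C′ (map (toLin' M) W) = map (toLin' M) (effAction (AᵀCA) W)` — whatever the source
block `B` (BGM 2006 §2.9: the external field is carried through every scale). [cite: BenfattoGiulianiMastropietro2006, §2.9 (4.3)-(4.6)] -/
theorem effAction_spectatorCov_map_doubleRows [Algebra ℚ R] (W : GrassmannAlgebra R Γ) :
    effAction R C' (ExteriorAlgebra.map (Matrix.toLin' M) W) = ExteriorAlgebra.map (Matrix.toLin' M) (effAction R (A.transpose * C * A) W) := by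
  rw [effAction_map, LinearMap.toMatrix'_toLin', transpose_mul_spectatorCov_mul_doubleRows C C' hC' A B M hM]

omit [DecidableEq Γ₁] in
/-- The partition-function twin: `Z_{C′}(map (toLin' M) W) = Z_{AᵀCA}(W)`. [cite: Salmhofer1999, App. B.2 (B.23)-(B.25)] -/
theorem effPartitionFn_spectatorCov_map_doubleRows [Algebra ℚ R] (W : GrassmannAlgebra R Γ) :
    effPartitionFn R C' (ExteriorAlgebra.map (Matrix.toLin' M) W) = effPartitionFn R (A.transpose * C * A) W := by
  rw [effPartitionFn_map, LinearMap.toMatrix'_toLin', transpose_mul_spectatorCov_mul_doubleRows C C' hC' A B M hM]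

end DoubleRows

/-! ## §2 The re-analysis to the next scale: block substitutions acting copy by copy -/

section DoubleBlock

variable {R : Type*} [CommRing R] {Γ Γ₁ Γ₂ : Type*} [Fintype Γ] [DecidableEq Γ] [Fintype Γ₁] [DecidableEq Γ₁] [Fintype Γ₂] [DecidableEq Γ₂]
  (T J : Matrix Γ₂ Γ₁ R) (Tp : Matrix (Γ₂ × Fin 2) (Γ₁ × Fin 2) R)
  (hTp : ∀ p' p, Tp p' p = if p'.2 = 0 ∧ p.2 = 0 then T p'.1 p.1 else if p'.2 = 1 ∧ p.2 = 1 then J p'.1 p.1 else 0)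
include hTp

omit [Fintype Γ] [DecidableEq Γ] [Fintype Γ₁] [DecidableEq Γ₁] [Fintype Γ₂] [DecidableEq Γ₂] in
/-- The block substitution sends sources to sources only (hypothesis of `GrassmannSourceGrading.map_mem_srcGE` / `srcTrunc_map_srcTrunc` with `P = (·.2 = 1)`).
[cite: BenfattoGiulianiMastropietro2006, §2.9 (4.3)-(4.6)] -/
theorem doubleBlock_src_of_src (p : Γ₁ × Fin 2) (p' : Γ₂ × Fin 2) (hp : p.2 = 1) (hp' : ¬ p'.2 = 1) : Tp p' p = 0 := by
  rw [hTp]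
  have hp0 : ¬ p.2 = 0 := by rw [hp]; exact one_ne_zero
  rw [if_neg (fun h => hp0 h.2), if_neg (fun h => hp' h.1)]

omit [Fintype Γ] [DecidableEq Γ] [Fintype Γ₁] [DecidableEq Γ₁] [Fintype Γ₂] [DecidableEq Γ₂] in
/-- The block substitution preserves the copy: `T⁺ p′ p ≠ 0 ⟹ (p.2 = 1 ↔ p′.2 = 1)` (hypothesis of `GrassmannSourceGradedStep.map_map_mulLeft_srcWeight_comm`).
[cite: BenfattoGiulianiMastropietro2006, §2.9 (4.3)-(4.6)] -/
theorem doubleBlock_copy_iff (p : Γ₁ × Fin 2) (p' : Γ₂ × Fin 2) (h : Tp p' p ≠ 0) : (p.2 = 1 ↔ p'.2 = 1) := by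
  rw [hTp] at h
  by_cases h0 : p'.2 = 0 ∧ p.2 = 0
  · rw [h0.1, h0.2]
  · rw [if_neg h0] at h
    by_cases h1 : p'.2 = 1 ∧ p.2 = 1
    · rw [h1.1, h1.2]
    · exact absurd (if_neg h1) h

variable (A : Matrix Γ₁ Γ R) (A' : Matrix Γ₂ Γ R) (B : Matrix Γ₁ Γ R) (B' : Matrix Γ₂ Γ R) (hA : T * A = A') (hB : J * B = B')
  (M : Matrix (Γ₁ × Fin 2) Γ R) (hM : ∀ p X, M p X = if p.2 = 0 then A p.1 X else B p.1 X)
  (M' : Matrix (Γ₂ × Fin 2) Γ R) (hM' : ∀ p' X, M' p' X = if p'.2 = 0 then A' p'.1 X else B' p'.1 X)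
include hA hB hM hM'

omit [Fintype Γ] [DecidableEq Γ] [DecidableEq Γ₁] [Fintype Γ₂] [DecidableEq Γ₂] in
/-- **`T⁺ · M = M′`**: the block substitution re-analyses copy by copy (`T·A = A′` on the alive copy, `J·B = B′` on the source copy). [folklore] -/
theorem doubleBlock_mul_doubleRows : Tp * M = M' := by
  have h10 : ¬ ((1 : Fin 2) = 0) := by decide
  have h01 : ¬ ((0 : Fin 2) = 1) := by decide
  ext p' X
  rw [Matrix.mul_apply, Fintype.sum_prod_type]
  simp only [Fin.sum_univ_two, hTp, hM, hM', Fin.isValue, h10, h01, if_true, if_false, and_true, and_false]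
  by_cases h0 : p'.2 = 0
  · have h1 : ¬ p'.2 = 1 := by rw [h0]; exact h01
    simp only [h0, h01, if_true, if_false, zero_mul, add_zero]
    rw [← hA, Matrix.mul_apply]
  · have h1 : p'.2 = 1 := by
      rcases Fin.exists_fin_two.1 ⟨p'.2, rfl⟩ with h | h
      · exact absurd h h0
      · exact h
    simp only [h1, h10, if_true, if_false, zero_mul, zero_add]
    rw [← hB, Matrix.mul_apply]

omit [Fintype Γ₂] [DecidableEq Γ₂] in
/-- **The re-analysis is ONE substitution**: `map (toLin' M′) W = map (toLin' T⁺) (map (toLin' M) W)`. [cite: BenfattoGiulianiMastropietro2006, §2.7 (2.70)-(2.71)] -/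
theorem map_doubleRows_eq_map_doubleBlock_map (W : GrassmannAlgebra R Γ) :
    ExteriorAlgebra.map (Matrix.toLin' M') W = ExteriorAlgebra.map (Matrix.toLin' Tp) (ExteriorAlgebra.map (Matrix.toLin' M) W) := by
  rw [map_map_eq_map_comp, ← Matrix.toLin'_mul, doubleBlock_mul_doubleRows T J Tp hTp A A' B B' hA hB M hM M' hM']

end DoubleBlock

/-! ## §3 The model instance: sector families (BGM 2006 §2.7) -/

section Sector

variable {L M : ℕ} [NeZero L] [NeZero M] {N N' : ℕ}

/-- **The alive block of the re-analysis reproduces the next analysis**: for a thin/fat pair `(F, F̃)` (`F̃F = F`) and a next family `F′` supported in the plateau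
`{Σ_ω F_ω = 1}`, `(ε • E(F′)) · S(F̃) · (ε • E(F)) = ε • E(F′)` (`S(F̃)·(ε•E(F)) = diag(Σ_ω F_ω)` and `F′` lives where that is `1`). [cite: BenfattoGiulianiMastropietro2006, §2.7 (2.70)-(2.71)] -/
theorem smul_sectorAnalysis_mul_sectorSub_mul_smul_sectorAnalysis {β : ℝ} (hβ : β ≠ 0) (F Ft : Fin N → FreqMomentum L M → ℂ)
    (hFF : ∀ ω k, Ft ω k * F ω k = F ω k) (F' : Fin N' → FreqMomentum L M → ℂ)
    (hF'pl : ∀ (ω' : Fin N') (k : FreqMomentum L M), F' ω' k ≠ 0 → ∑ ω, F ω k = 1) :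
    (((imagTimeWeight β M : ℝ) : ℂ) • sectorAnalysisMatrix L M β F') * sectorSubMatrix L M β Ft *
        ((((imagTimeWeight β M : ℝ) : ℂ)) • sectorAnalysisMatrix L M β F) =
      ((imagTimeWeight β M : ℝ) : ℂ) • sectorAnalysisMatrix L M β F' := by
  rw [Matrix.mul_assoc, sectorSubMatrix_mul_smul_sectorAnalysisMatrix_of_fat hβ F Ft hFF, Matrix.smul_mul]
  congr 1
  ext Y K
  rw [Matrix.mul_diagonal]
  by_cases hE : sectorAnalysisMatrix L M β F' Y K = 0
  · rw [hE, zero_mul]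
  · have hF' : F' Y.2.1.1 K.1.1 ≠ 0 := by
      intro h0
      apply hE
      rw [sectorAnalysisMatrix_apply]
      split_ifs
      · rw [h0, zero_mul]
      · rfl
    rw [hF'pl _ _ hF', mul_one]

/-- **THE DOUBLED STEP IS EXACT** (model instance of `effAction_spectatorCov_map_doubleRows`): for the alive block `A = ε • E(F)`, the sector-field slice covariance
`C = S(F̃)ᵀ C₀ S(F̃)` of a momentum covariance `C₀` supported in the plateau of `F`, and ANY source block `B`:
`effAction C′ (map (toLin' M) W) = map (toLin' M) (effAction C₀ W)` — with `W = 𝒱⁽ʲ⁾`, `C₀` the slice `(Λ_{j+1}, Λ_j]`: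
the spectator step of the doubled-analysed scale-`j` action IS the doubled analysis (same families) of `𝒱⁽ʲ⁺¹⁾`. [cite: BenfattoGiulianiMastropietro2006, §2.9 (4.3)-(4.6)] -/
theorem effAction_spectatorCov_map_doubleRows_sector {β : ℝ} (hβ : β ≠ 0) (F Ft : Fin N → FreqMomentum L M → ℂ)
    (hFF : ∀ ω k, Ft ω k * F ω k = F ω k) (C₀ : Matrix (HubbardFieldIdx L M) (HubbardFieldIdx L M) ℂ)
    (hCpl : ∀ X Y, C₀ X Y ≠ 0 → ∑ ω, F ω X.1.1 = 1 ∧ ∑ ω, F ω Y.1.1 = 1)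
    (C' : Matrix ((SpaceTimeIdx L M × SectorLeg N) × Fin 2) ((SpaceTimeIdx L M × SectorLeg N) × Fin 2) ℂ)
    (hC' : ∀ p q, C' p q = if p.2 = 0 ∧ q.2 = 0 then
      ((sectorSubMatrix L M β Ft).transpose * C₀ * sectorSubMatrix L M β Ft) p.1 q.1 else 0)
    (B : Matrix (SpaceTimeIdx L M × SectorLeg N) (HubbardFieldIdx L M) ℂ) (Mx : Matrix ((SpaceTimeIdx L M × SectorLeg N) × Fin 2) (HubbardFieldIdx L M) ℂ)
    (hMx : ∀ p X, Mx p X = if p.2 = 0 then ((((imagTimeWeight β M : ℝ) : ℂ)) • sectorAnalysisMatrix L M β F) p.1 X else B p.1 X)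
    (W : HubbardGrassmann L M) :
    effAction ℂ C' (ExteriorAlgebra.map (Matrix.toLin' Mx) W) = ExteriorAlgebra.map (Matrix.toLin' Mx) (effAction ℂ C₀ W) := by
  rw [effAction_spectatorCov_map_doubleRows ((sectorSubMatrix L M β Ft).transpose * C₀ * sectorSubMatrix L M β Ft) C' hC' _ B Mx hMx]
  congr 2
  have h := smul_sectorAnalysis_factorisation (Γ := HubbardFieldIdx L M) hβ F Ft hFF C₀ hCpl (1 : Matrix (HubbardFieldIdx L M) (HubbardFieldIdx L M) ℂ)
  rwa [Matrix.mul_one, Matrix.transpose_one, Matrix.one_mul, Matrix.mul_one] at h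

/-- The partition function of the doubled step is that of the momentum-space step: `Z_{C′}(map (toLin' M) W) = Z_{C₀}(W)`.
[cite: BenfattoGiulianiMastropietro2006, §2.9 (4.3)-(4.6)] -/
theorem effPartitionFn_spectatorCov_map_doubleRows_sector {β : ℝ} (hβ : β ≠ 0) (F Ft : Fin N → FreqMomentum L M → ℂ)
    (hFF : ∀ ω k, Ft ω k * F ω k = F ω k) (C₀ : Matrix (HubbardFieldIdx L M) (HubbardFieldIdx L M) ℂ)
    (hCpl : ∀ X Y, C₀ X Y ≠ 0 → ∑ ω, F ω X.1.1 = 1 ∧ ∑ ω, F ω Y.1.1 = 1)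
    (C' : Matrix ((SpaceTimeIdx L M × SectorLeg N) × Fin 2) ((SpaceTimeIdx L M × SectorLeg N) × Fin 2) ℂ)
    (hC' : ∀ p q, C' p q = if p.2 = 0 ∧ q.2 = 0 then
      ((sectorSubMatrix L M β Ft).transpose * C₀ * sectorSubMatrix L M β Ft) p.1 q.1 else 0)
    (B : Matrix (SpaceTimeIdx L M × SectorLeg N) (HubbardFieldIdx L M) ℂ) (Mx : Matrix ((SpaceTimeIdx L M × SectorLeg N) × Fin 2) (HubbardFieldIdx L M) ℂ)
    (hMx : ∀ p X, Mx p X = if p.2 = 0 then ((((imagTimeWeight β M : ℝ) : ℂ)) • sectorAnalysisMatrix L M β F) p.1 X else B p.1 X)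
    (W : HubbardGrassmann L M) :
    effPartitionFn ℂ C' (ExteriorAlgebra.map (Matrix.toLin' Mx) W) = effPartitionFn ℂ C₀ W := by
  rw [effPartitionFn_spectatorCov_map_doubleRows ((sectorSubMatrix L M β Ft).transpose * C₀ * sectorSubMatrix L M β Ft) C' hC' _ B Mx hMx]
  congr 1
  have h := smul_sectorAnalysis_factorisation (Γ := HubbardFieldIdx L M) hβ F Ft hFF C₀ hCpl (1 : Matrix (HubbardFieldIdx L M) (HubbardFieldIdx L M) ℂ)
  rwa [Matrix.mul_one, Matrix.transpose_one, Matrix.one_mul, Matrix.mul_one] at h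

/-- **ONE SCALE OF THE DOUBLED TOWER = SPECTATOR STEP, THEN ONE SUBSTITUTION.**  With the alive blocks `ε•E(F)` (scale `j`) and `ε•E(F′)` (scale `j+1`, `F′` inside the
plateau of the thin/fat pair `(F, F̃)`), source blocks `B`, `B′` related by `J·B = B′`, the block substitution `T⁺ = (ε•E(F′)·S(F̃)) ⊕ J`, and a momentum covariance `C₀`
supported in the plateau: `map (toLin' M′) (effAction C₀ W) = map (toLin' T⁺) (effAction C′ (map (toLin' M) W))` — the next doubled-analysed action is ONE substitution of the
spectator step of the present one. [cite: BenfattoGiulianiMastropietro2006, §2.7 (2.70)-(2.71)] -/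
theorem map_doubleRows_effAction_eq_map_doubleBlock_effAction {β : ℝ} (hβ : β ≠ 0) (F Ft : Fin N → FreqMomentum L M → ℂ)
    (hFF : ∀ ω k, Ft ω k * F ω k = F ω k) (F' : Fin N' → FreqMomentum L M → ℂ)
    (hF'pl : ∀ (ω' : Fin N') (k : FreqMomentum L M), F' ω' k ≠ 0 → ∑ ω, F ω k = 1)
    (C₀ : Matrix (HubbardFieldIdx L M) (HubbardFieldIdx L M) ℂ) (hCpl : ∀ X Y, C₀ X Y ≠ 0 → ∑ ω, F ω X.1.1 = 1 ∧ ∑ ω, F ω Y.1.1 = 1)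
    (C' : Matrix ((SpaceTimeIdx L M × SectorLeg N) × Fin 2) ((SpaceTimeIdx L M × SectorLeg N) × Fin 2) ℂ)
    (hC' : ∀ p q, C' p q = if p.2 = 0 ∧ q.2 = 0 then
      ((sectorSubMatrix L M β Ft).transpose * C₀ * sectorSubMatrix L M β Ft) p.1 q.1 else 0)
    (B : Matrix (SpaceTimeIdx L M × SectorLeg N) (HubbardFieldIdx L M) ℂ) (B' : Matrix (SpaceTimeIdx L M × SectorLeg N') (HubbardFieldIdx L M) ℂ)
    (J : Matrix (SpaceTimeIdx L M × SectorLeg N') (SpaceTimeIdx L M × SectorLeg N) ℂ) (hB : J * B = B')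
    (Tp : Matrix ((SpaceTimeIdx L M × SectorLeg N') × Fin 2) ((SpaceTimeIdx L M × SectorLeg N) × Fin 2) ℂ)
    (hTp : ∀ p' p, Tp p' p = if p'.2 = 0 ∧ p.2 = 0 then
      ((((imagTimeWeight β M : ℝ) : ℂ) • sectorAnalysisMatrix L M β F') * sectorSubMatrix L M β Ft) p'.1 p.1
      else if p'.2 = 1 ∧ p.2 = 1 then J p'.1 p.1 else 0)
    (Mx : Matrix ((SpaceTimeIdx L M × SectorLeg N) × Fin 2) (HubbardFieldIdx L M) ℂ)
    (hMx : ∀ p X, Mx p X = if p.2 = 0 then ((((imagTimeWeight β M : ℝ) : ℂ)) • sectorAnalysisMatrix L M β F) p.1 X else B p.1 X)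
    (Mx' : Matrix ((SpaceTimeIdx L M × SectorLeg N') × Fin 2) (HubbardFieldIdx L M) ℂ)
    (hMx' : ∀ p' X, Mx' p' X = if p'.2 = 0 then ((((imagTimeWeight β M : ℝ) : ℂ)) • sectorAnalysisMatrix L M β F') p'.1 X else B' p'.1 X)
    (W : HubbardGrassmann L M) :
    ExteriorAlgebra.map (Matrix.toLin' Mx') (effAction ℂ C₀ W) = ExteriorAlgebra.map (Matrix.toLin' Tp) (effAction ℂ C' (ExteriorAlgebra.map (Matrix.toLin' Mx) W)) := by
  rw [effAction_spectatorCov_map_doubleRows_sector hβ F Ft hFF C₀ hCpl C' hC' B Mx hMx,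
    map_doubleRows_eq_map_doubleBlock_map _ J Tp hTp _ _ B B'
      (smul_sectorAnalysis_mul_sectorSub_mul_smul_sectorAnalysis hβ F Ft hFF F' hF'pl) hB Mx hMx Mx' hMx']

end Sector

end Summit.HubbardSuperconductivity.HubbardSuperconductivity.Theorems.TwoVolumeDefect

end
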